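import Summits.ResolutionOfSingularities.ResolutionOfSingularities.Theorems.DeltaCutStellarLatJGuard
import Summits.ResolutionOfSingularities.ResolutionOfSingularities.Theorems.DeltaCutStellarLatLaw

/-!
# StellarCut J21d — «LatJet»: the LATENT-JET LAW, the frame-level class `IsNCHypStageLatJ`, the cell `WORNCHypWildLatJ` carved out of
# `WORNCHypWildRest3`, and the new remainder `WORNCHypWildRest4` (lens-6 «barrier-complement carving», g36 door 2)

THE CARVE (exact, hyp-free, by excluded middle on ONE intrinsic clause of the stage):
`WORNCHypWildRest3 n ⟺ WORNCHypWildLatJ n ∧ WORNCHypWildRest4 n` (`worNCHypWildRest3_iff_latJ_rest4`), the clause being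
`p = n ∧ IsNCHypStageLatJ p ⟨Y, M.ideal⟩` — the stage carries an s.n.c. frame in the LATENT-JET shape (Artin–Schreier presentation,
NO label arithmetic, plus a logarithmic eigen-datum `δ(v·c·m_b) = λ·(v·c·m_b)`, `λ` a unit) with top locus on `H`.

THE LAW (`worNCHypWildLatJ_holds (n) (hn : 1 ≤ n)`, hyp-free): the binders give a list-level `ncHypShapeLatJ p`-datum (bridge
`exists_ncHypShapeLatJ_of_isNCHypStageLatJ`); the LIST LAW `exists_weakResolution_of_ncHypShapeLatJ` runs by strong induction on L20's
LATENT MASS: while it is positive, blow up a face `V(H) ∩ V(K)` with `μ_K ≥ 1` (permissible: J21a; the shape AND THE DATUM persist with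
no hypothesis: J21c `ncHypShapeLatJ.transform`, eigenvalue exact by `p = 0`; the mass drops: J21c); at mass `0` the datum IS a T19 jet datum
at every `p`-divisible point (J21a `ncHypShapeLatJ.toJet`) and T19's JET LAW `exists_weakResolution_of_ncHypShapeJet` finishes BY NAME.

THE NEW REMAINDER `WORNCHypWildRest4 n` (UNDECIDED, typed with test data): the binders of `WORNCHypWildRest3 n` PLUS
`¬ (p = n ∧ IsNCHypStageLatJ p ⟨Y, M.ideal⟩)`.  Known test data: (i-b) at `p = n = 2` the ALL-EVEN Artin–Schreier data — census (2,4)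
`u = 1 + x² + xz` and (4,4) `u = 1 + x + x²`, both `b = (2,2)`: every logarithmic derivation kills `m_b` modulo `p`, no eigen-datum
(IDEA-NEEDED «EvenLatent»: a second-order / residual-transcendence datum); (ii) `x² + (1 + z³ + w³)z²w²` — «polynomial-tail»,
IDEA-NEEDED; (iii) `n = p·m`, `m ≥ 2` — UNDECIDED (round stability of divisibility data fails at composite markings).  The class is
NOT claimed to exhaust `WORNCHypWildRest3`; its desk members are the four MIXED-PARITY latent data of Rest3's family (i): Hauser's
oblique kangaroo `x² + (1+xz)z²w²` (`b = (2,1)`, kernel inhabitant J21e), `x² + (1+x+z)z²w²` (`b = (1,2)`), census (4,4) `1+x²+xz`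
(`b = (3,2)`), (6,6) `1+x²+xw` (`b = (3,4)`) — for the Euler-type logarithmic derivation the eigenvalue is `Σ_K b_K (mod p)`.

0 sorry; axioms standard. [new] [cite: CossartPiltant2008, Prop. 4.2] [cite: Kollar2007, (3.111) Step 3] [cite: Hauser2010, §§3–5]
[cite: Cutkosky2011, §8]
-/
noncomputable section

open CategoryTheory CategoryTheory.Limits AlgebraicGeometry TopologicalSpace IsLocalRing
open Literature.AlgebraicGeometry.Resolution

namespace Summit.ResolutionOfSingularities.ResolutionOfSingularities.Theorems.DeltaCutClasses

open Summit.ResolutionOfSingularities.ResolutionOfSingularities.Theorems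
open WeakOrderReduction ForcedTowerClasses

/-! ### §ListLaw — weak order reduction for the latent-jet shape -/

section ListLaw

/-- ★★ **THE LIST-LEVEL LATENT-JET LAW** (strong induction on the latent mass): on a locally Noetherian scheme, a `ncHypShapeLatJ p`-datum
for a labelled boundary `E ∋ H` with `H :: ∂E` s.n.c. admits a weak resolution — latent hops at codimension-two faces `V(H) ∩ V(K)` while
the mass is positive (J21c, datum transported), then — mass `0` IS T19's jet shape (J21a `toJet`) — the JET LAW
`exists_weakResolution_of_ncHypShapeJet` BY NAME. [new] [cite: CossartPiltant2008, Prop. 4.2] [cite: Kollar2007, (3.111) Step 3] -/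
theorem exists_weakResolution_of_ncHypShapeLatJ {p : ℕ} : ∀ (N : ℕ) {X : Scheme.{0}} [IsLocallyNoetherian X]
    {E L : List (X.IdealSheafData × ℕ)} {H : X.IdealSheafData} (M : MarkedIdeal X), latMass L H = N →
      HasSNC (H :: boundaryOf E) → H ∈ boundaryOf E → ncHypShapeLatJ p X E L H M → ∃ s : CentreSeq X, WeakResolution s M := by
  intro N
  induction N using Nat.strong_induction_on with
  | _ N ih =>
  intro X _ E L H M hN hEs hH hP
  by_cases h0 : latMass L H = 0
  · -- terminal: the datum is a jet datum (J21a `ncHypShapeLatJ.toJet`); the JET LAW by name (T19b-iii)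
    exact exists_weakResolution_of_ncHypShapeJet hEs hH M (hP.toJet hEs h0)
  · -- a latent hop at `V(H) ∩ V(K)`, the datum carried along
    obtain ⟨q, hq, hne, hq1⟩ := exists_entry_of_latMass_ne_zero h0
    have hK : q.1 ∈ boundaryOf E := hP.boundaryOf_eq ▸ fst_mem_boundaryOf hq
    have hLK : 1 ≤ expOf L q.1 := hq1.trans (label_le_expOf hq)
    have hHK : H ≠ q.1 := by
      intro hHK
      rcases hP.labelL hq hHK.symm with h | h
      · omega
      · have hne' := hne.mono Set.inter_subset_right
        rw [h] at hne'
        exact Set.not_nonempty_empty hne'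
    have hne' : ((q.1.support : Set X) ∩ H.support).Nonempty := hne
    have hT : ∀ K' ∈ pairFace H q.1, K' ∈ H :: boundaryOf E := pair_subset_frame hK
    have hπ := blowup.isBlowup ((pairFace H q.1).sup id)
    haveI : IsProper (blowup.π ((pairFace H q.1).sup id)) := hπ.isProper
    haveI : IsLocallyNoetherian (blowup ((pairFace H q.1).sup id)) :=
      LocallyOfFiniteType.isLocallyNoetherian (blowup.π ((pairFace H q.1).sup id))
    have hP' := hP.transform hEs hK hHK hπ hLK
    have hEs' := hasSNC_ncShape_transform hEs hT hπ 0
    have hH' : strictTransformIdeal (blowup.π ((pairFace H q.1).sup id)) ((pairFace H q.1).sup id) H ∈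
        boundaryOf (transformExp E (blowup.π ((pairFace H q.1).sup id)) (pairFace H q.1) 0) := by
      rw [boundaryOf_transformExp]
      exact List.mem_append_left _ (List.mem_map.mpr ⟨H, hH, rfl⟩)
    have hlt := hP.latMass_transform_lt hEs hK hHK hπ hLK hne'
    rw [hN] at hlt
    obtain ⟨rest, hrest⟩ := ih _ hlt (M.transform (blowup.π ((pairFace H q.1).sup id)) ((pairFace H q.1).sup id)) rfl hEs' hH' hP'
    exact ⟨.cons ((pairFace H q.1).sup id) rest,
      ⟨hP.support_pair_subset hLK, hEs.isRegular_subscheme_finsetSup _ hT, hrest.1⟩, hrest.2⟩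

/-- ★★ the latent-jet law, mass unquantified. [new] -/
theorem ncHypShapeLatJ.exists_weakResolution {p : ℕ} {X : Scheme.{0}} [IsLocallyNoetherian X]
    {E L : List (X.IdealSheafData × ℕ)} {H : X.IdealSheafData} {M : MarkedIdeal X} (hP : ncHypShapeLatJ p X E L H M)
    (hEs : HasSNC (H :: boundaryOf E)) (hH : H ∈ boundaryOf E) : ∃ s : CentreSeq X, WeakResolution s M :=
  exists_weakResolution_of_ncHypShapeLatJ (latMass L H) M rfl hEs hH hP

end ListLaw

/-! ### §Class — the frame-level latent-jet class -/

section Class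

open AlgebraicGeometry.Scheme.IdealSheafData (vanishingIdeal)

/-- **`F.LatJShape p μ` — THE LATENT-JET SHAPE of an n.c. frame** on the stage `N = (Y, 𝓘)` with latent label vector `μ`: at every
`y ∈ H` a latent-jet datum (`LatJAt`, J21a) for `𝓘` with respect to the frame lists `(𝓘(H), 0) :: [(𝓘(Dᵢ), aᵢ)]ᵢ` (terminal labels) and
`(𝓘(H), 0) :: [(𝓘(Dᵢ), μᵢ)]ᵢ` (latent labels): Artin–Schreier presentation `𝓘_y = (hᵖ + v·(h − c·m_μ)·m_b·m_μ^{p−1})` PLUS a derivation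
of `𝒪_y`, logarithmic along `H` and the `Dᵢ` through `y`, with `δ(v·c·m_b) = λ·(v·c·m_b)`, `λ ∈ 𝒪_y^×`.  (Hauser's oblique kangaroo
`x² + (1+xz)z²w² = h² + (h + zw)·z²w·zw`, `h = x + zw`: `δ = w∂_w`, `λ = 1`.) DEFINITION (the «LatJet» class). [new] [cite: Hauser2010, §5]
[cite: CossartPiltant2008, Prop. 4.2] -/
def NCFrame.LatJShape (p : ℕ) {N : Stage} (F : NCFrame N) (μ : Fin F.r → ℕ) : Prop :=
  ∀ y : N.Y, y ∈ (F.H : Set N.Y) →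
    LatJAt p ((vanishingIdeal F.H, 0) :: F.expList) ((vanishingIdeal F.H, 0) :: (F.relabel μ).expList) (vanishingIdeal F.H) N.I y

/-- **`IsNCHypStageLatJ p N` — LATENT-JET n.c. stage at the pure-characteristic marking `p`**: an s.n.c. frame with a latent label vector
in the latent-jet shape, top locus on `H` (`SuppLE p`); NO arithmetic condition on the labels. DEFINITION (the latent-jet class). [new] -/
def IsNCHypStageLatJ (p : ℕ) (N : Stage) : Prop :=
  ∃ (F : NCFrame N) (μ : Fin F.r → ℕ), F.IsSNC ∧ F.LatJShape p μ ∧ F.SuppLE p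

end Class

/-! ### §Cells — the latent-jet cell, the new remainder, the exact carve -/

section Cells

/-- **`WORNCHypWildLatJ n` — THE LATENT-JET CELL**: the binders of `WORNCHypWildRest3 n` (L20d) VERBATIM, PLUS `p = n` and a latent-jet
frame (`IsNCHypStageLatJ p`).  DECIDED · HOLDS (`worNCHypWildLatJ_holds`; `worNCHypWildLatJ_all` at every `n`).  Kernel-inhabited (J21e):
Hauser's oblique kangaroo `x² + (1+xz)z²w²` over `𝔽₂` (latent mass `2`, terminal labels `(2, 1)` EVEN on `z`: outside L20's latent class
and outside T19's jet class with its binomial frame). [new] [cite: Hauser2010, §§3–5] -/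
def WORNCHypWildLatJ (n : ℕ) : Prop :=
  ∀ p : ℕ, p.Prime → ∀ (k : Type) [Field k] [CharP k p] (Y : Scheme.{0}) (g : Y ⟶ Spec (.of k)),
    IsBase Y g → p ∣ n → ∀ M : MarkedIdeal Y, IsDatum n M → IsNCHypStage n ⟨Y, M.ideal⟩ →
      ¬ (p = n ∧ IsNCHypStageJet p n ⟨Y, M.ideal⟩) → ¬ (p = n ∧ IsNCHypStageLat p ⟨Y, M.ideal⟩) →
        (p = n ∧ IsNCHypStageLatJ p ⟨Y, M.ideal⟩) → ∃ t : CentreSeq Y, WeakResolution t M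

/-- **`WORNCHypWildRest4 n` — THE REMAINDER AFTER THE LATENT-JET CELL**: the binders of `WORNCHypWildRest3 n` verbatim PLUS
`¬ (p = n ∧ IsNCHypStageLatJ p)`.  UNDECIDED · TYPED WITH TEST DATA (module docstring): (i-b) the all-even Artin–Schreier data (census (2,4)
`1+x²+xz`, (4,4) `1+x+x²`; `b = (2,2)`) — «EvenLatent», IDEA-NEEDED; (ii) `x² + (1+z³+w³)z²w²` — «polynomial-tail», IDEA-NEEDED;
(iii) `n = p·m`, `m ≥ 2` — UNDECIDED. [new] [cite: Hauser2010, §§3–5] -/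
def WORNCHypWildRest4 (n : ℕ) : Prop :=
  ∀ p : ℕ, p.Prime → ∀ (k : Type) [Field k] [CharP k p] (Y : Scheme.{0}) (g : Y ⟶ Spec (.of k)),
    IsBase Y g → p ∣ n → ∀ M : MarkedIdeal Y, IsDatum n M → IsNCHypStage n ⟨Y, M.ideal⟩ →
      ¬ (p = n ∧ IsNCHypStageJet p n ⟨Y, M.ideal⟩) → ¬ (p = n ∧ IsNCHypStageLat p ⟨Y, M.ideal⟩) →
        ¬ (p = n ∧ IsNCHypStageLatJ p ⟨Y, M.ideal⟩) → ∃ t : CentreSeq Y, WeakResolution t M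

/-- ★ **THE CARVE OF THE REMAINDER BY THE LATENT-JET CLASS (exact, hyp-free, pure logic)**:
`WORNCHypWildRest3 n ⟺ WORNCHypWildLatJ n ∧ WORNCHypWildRest4 n`. [new] -/
theorem worNCHypWildRest3_iff_latJ_rest4 (n : ℕ) : WORNCHypWildRest3 n ↔ WORNCHypWildLatJ n ∧ WORNCHypWildRest4 n := by
  constructor
  · intro h
    exact ⟨fun p hp k _ _ Y g hB hd M hM hS hc hl _ => h p hp k Y g hB hd M hM hS hc hl,
      fun p hp k _ _ Y g hB hd M hM hS hc hl _ => h p hp k Y g hB hd M hM hS hc hl⟩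
  · rintro ⟨hL, hR⟩ p hp k _ _ Y g hB hd M hM hS hc hl
    by_cases hj : p = n ∧ IsNCHypStageLatJ p ⟨Y, M.ideal⟩
    · exact hL p hp k Y g hB hd M hM hS hc hl hj
    · exact hR p hp k Y g hB hd M hM hS hc hl hj

/-- the FAMILY of latent-jet cells (all markings `n ≥ 1`) -/
def E1NCHypWildLatJ : Prop := ∀ n : ℕ, 1 ≤ n → WORNCHypWildLatJ n

/-- the FAMILY of new remainders (all markings `n ≥ 1`): the column's LOCATED RESIDUAL after g36 door 2. UNDECIDED · typed with test data. -/
def E1NCHypWildRest4 : Prop := ∀ n : ℕ, 1 ≤ n → WORNCHypWildRest4 n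

/-- families: `E1NCHypWildRest3 ⟺ E1NCHypWildLatJ ∧ E1NCHypWildRest4` (exact, pure logic). [new] -/
theorem e1NCHypWildRest3_iff_latJ_rest4 : E1NCHypWildRest3 ↔ E1NCHypWildLatJ ∧ E1NCHypWildRest4 :=
  ⟨fun h => ⟨fun n hn => ((worNCHypWildRest3_iff_latJ_rest4 n).mp (h n hn)).1,
    fun n hn => ((worNCHypWildRest3_iff_latJ_rest4 n).mp (h n hn)).2⟩,
    fun h n hn => (worNCHypWildRest3_iff_latJ_rest4 n).mpr ⟨h.1 n hn, h.2 n hn⟩⟩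

end Cells

/-! ### §Law — the bridge from the binders and the latent-jet law -/

section Law

open AlgebraicGeometry.Scheme.IdealSheafData (vanishingIdeal)

variable {Y : Scheme.{0}}

/-- **THE BRIDGE from a latent-jet frame to the list shape** (regular Noetherian `Y`, `p` prime vanishing in the stalks, marking `p`):
`ncHypShapeLatJ p Y E L 𝓘(H) M` for `E := (𝓘(H), 0) :: [(𝓘(Dᵢ), aᵢ)]ᵢ`, `L := (𝓘(H), 0) :: [(𝓘(Dᵢ), μᵢ)]ᵢ`. [new] [folklore] -/
theorem ncHypShapeLatJ_of_frame [IsNoetherian Y] (hY : Scheme.IsRegular Y) {p : ℕ} (hp : p.Prime)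
    (hpY : ∀ y : Y, ((p : ℕ) : Y.presheaf.stalk y) = 0) {M : MarkedIdeal Y} (hμM : M.mult = p)
    {F : NCFrame ⟨Y, M.ideal⟩} {μ : Fin F.r → ℕ} (hS : F.IsSNC) (hF : F.LatJShape p μ) (hSupp : F.SuppLE p) :
    vanishingIdeal F.H ∈ boundaryOf ((vanishingIdeal F.H, 0) :: F.expList) ∧
      HasSNC (vanishingIdeal F.H :: boundaryOf ((vanishingIdeal F.H, 0) :: F.expList)) ∧
      ncHypShapeLatJ p Y ((vanishingIdeal F.H, 0) :: F.expList) ((vanishingIdeal F.H, 0) :: (F.relabel μ).expList)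
        (vanishingIdeal F.H) M := by
  have hEs : HasSNC (vanishingIdeal F.H :: boundaryOf ((vanishingIdeal F.H, 0) :: F.expList)) := by
    refine hS.hasSNC_of_forall_mem hY fun K hK => ?_
    have hK : K = vanishingIdeal F.H ∨ K ∈ boundaryOf F.expList := by
      simpa only [List.map_cons, List.mem_cons, or_self_left] using hK
    rcases hK with rfl | hK
    · exact ⟨none, rfl⟩
    · obtain ⟨i, rfl⟩ := F.mem_boundaryOf_expList_iff.mp hK
      exact ⟨some i, rfl⟩
  refine ⟨List.mem_cons_self, hEs, hμM, hS.label_cons_expList, (hS.relabel μ).label_cons_expList, ?_,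
    fun y hy => hF y (mem_support_vanishingIdeal_iff.mp hy), ?_, hp, hpY⟩
  · -- the two boundary lists agree
    show boundaryOf ((vanishingIdeal F.H, 0) :: (F.relabel μ).expList) = boundaryOf ((vanishingIdeal F.H, 0) :: F.expList)
    simp only [boundaryOf, List.map_cons]
    exact congrArg _ (F.boundaryOf_expList_relabel μ)
  · -- `supp(M) ⊆ V(𝓘(H))`
    intro y hy
    rw [SetLike.mem_coe, mem_support_vanishingIdeal_iff]
    refine hSupp y ((le_idealOrder_iff M.ideal y p).mpr ?_)
    have := (MarkedIdeal.mem_support_iff M y).mp hy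
    rwa [hμM] at this

/-- **THE BRIDGE from the binders**: a base `p`-datum over a field of characteristic `p` whose stage is a latent-jet n.c. stage is a
`ncHypShapeLatJ p`-datum with `H :: ∂E` s.n.c. and `H ∈ ∂E`. [new] [folklore] -/
theorem exists_ncHypShapeLatJ_of_isNCHypStageLatJ {p : ℕ} (hp : p.Prime) {k : Type} [Field k] [CharP k p]
    (g : Y ⟶ Spec (.of k)) (hB : IsBase Y g) {M : MarkedIdeal Y} (hM : IsDatum p M) (hNC : IsNCHypStageLatJ p ⟨Y, M.ideal⟩) :
    ∃ (E L : List (Y.IdealSheafData × ℕ)) (H : Y.IdealSheafData),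
      HasSNC (H :: boundaryOf E) ∧ H ∈ boundaryOf E ∧ ncHypShapeLatJ p Y E L H M := by
  haveI := hB.locallyOfFiniteType
  haveI := hB.quasiCompact
  haveI : IsLocallyNoetherian Y := LocallyOfFiniteType.isLocallyNoetherian g
  haveI : CompactSpace Y := QuasiCompact.compactSpace_of_compactSpace g
  haveI : IsNoetherian Y := {}
  obtain ⟨F, μ, hS, hF, hSupp⟩ := hNC
  obtain ⟨hH, hEs, hP⟩ := ncHypShapeLatJ_of_frame hB.isRegular hp (natCast_stalk_eq_zero_of_charP p g) hM.1 hS hF hSupp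
  exact ⟨_, _, _, hEs, hH, hP⟩

/-- ★★ **THE LATENT-JET LAW, frame level, hyp-free**: over a field of characteristic `p`, a base `p`-datum whose stage is a LATENT-JET
n.c. stage admits a weak resolution. [new] [cite: CossartPiltant2008, Prop. 4.2] [cite: Kollar2007, (3.111) Step 3] -/
theorem worLatJ_holds {p : ℕ} (hp : p.Prime) {k : Type} [Field k] [CharP k p] (g : Y ⟶ Spec (.of k)) (hB : IsBase Y g)
    (M : MarkedIdeal Y) (hM : IsDatum p M) (hNC : IsNCHypStageLatJ p ⟨Y, M.ideal⟩) : ∃ t : CentreSeq Y, WeakResolution t M := by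
  haveI := hB.locallyOfFiniteType
  haveI := hB.quasiCompact
  haveI : IsLocallyNoetherian Y := LocallyOfFiniteType.isLocallyNoetherian g
  obtain ⟨E, L, H, hEs, hH, hP⟩ := exists_ncHypShapeLatJ_of_isNCHypStageLatJ hp g hB hM hNC
  exact hP.exists_weakResolution hEs hH

/-- the latent-jet cell at EVERY level `n` (composite and zero levels are vacuous: `p = n` with `p` prime). [new] -/
theorem worNCHypWildLatJ_all (n : ℕ) : WORNCHypWildLatJ n := by
  intro p hp k _ _ Y g hB _ M hM _ _ _ hj
  obtain ⟨hpn, hNC⟩ := hj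
  subst hpn
  exact worLatJ_holds hp g hB M hM hNC

/-- ★★ **THE LATENT-JET CELL IS DECIDED · HOLDS** — `WORNCHypWildLatJ n` for every `n ≥ 1`: at the pure-characteristic marking `p = n`,
a base `n`-datum whose stage is a LATENT-JET s.n.c. stage admits a weak resolution — latent hops at the codimension-two faces
`V(H) ∩ V(K)` carrying the eigen-datum (J21c) until the latent mass vanishes, then T19's jet law at the `p`-divisible points (J21a
`toJet`).  The cell `WORNCHypWildLatJ` of the carving `worNCHypWildRest3_iff_latJ_rest4` is DECIDED · HOLDS; `WORNCHypWildRest4` stays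
UNDECIDED. [new] [cite: CossartPiltant2008, Prop. 4.2] [cite: Kollar2007, (3.111) Step 3] [cite: Hauser2010, §5] -/
theorem worNCHypWildLatJ_holds (n : ℕ) (_hn : 1 ≤ n) : WORNCHypWildLatJ n := worNCHypWildLatJ_all n

/-- the FAMILY of latent-jet cells holds. [new] -/
theorem e1NCHypWildLatJ_holds : E1NCHypWildLatJ := worNCHypWildLatJ_holds

-- the law, fully qualified, binders `n` / `1 ≤ n` only.
example (n : ℕ) (hn : 1 ≤ n) :
    Summit.ResolutionOfSingularities.ResolutionOfSingularities.Theorems.DeltaCutClasses.WORNCHypWildLatJ n :=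
  worNCHypWildLatJ_holds n hn

example : WORNCHypWildLatJ 4 := fun p hp _ _ _ _ _ _ _ _ _ _ _ _ h4 => absurd (h4.1 ▸ hp) (by decide)

/-- ★ **THE REMAINDER IS ITS NEW REMAINDER (exact)**: `WORNCHypWildRest3 n ⟺ WORNCHypWildRest4 n`. [new] -/
theorem worNCHypWildRest3_iff_rest4 (n : ℕ) : WORNCHypWildRest3 n ↔ WORNCHypWildRest4 n := by
  rw [worNCHypWildRest3_iff_latJ_rest4]
  exact ⟨fun h => h.2, fun h => ⟨worNCHypWildLatJ_all n, h⟩⟩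

/-- ★ per level, the wild cell reduces to the new remainder: `WORNCHypWild n ⟺ WORNCHypWildRest4 n` (exact). [new] -/
theorem worNCHypWild_iff_rest4 (n : ℕ) : WORNCHypWild n ↔ WORNCHypWildRest4 n :=
  (worNCHypWild_iff_rest3 n).trans (worNCHypWildRest3_iff_rest4 n)

/-- per level: `WORNCHypWildRest4 n → WORNCHyp n`. [new] -/
theorem worNCHyp_of_wildRest4 {n : ℕ} (hn : 1 ≤ n) (hR : WORNCHypWildRest4 n) : WORNCHyp n :=
  worNCHyp_of_wildRest3 hn ((worNCHypWildRest3_iff_rest4 n).mpr hR)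

/-- families: `E1NCHypWildRest3 ⟺ E1NCHypWildRest4` (exact). [new] -/
theorem e1NCHypWildRest3_iff_rest4 : E1NCHypWildRest3 ↔ E1NCHypWildRest4 :=
  ⟨fun h n hn => (worNCHypWildRest3_iff_rest4 n).mp (h n hn), fun h n hn => (worNCHypWildRest3_iff_rest4 n).mpr (h n hn)⟩

/-- families: `E1NCHypWild ⟺ E1NCHypWildRest4` (exact). [new] -/
theorem e1NCHypWild_iff_rest4 : E1NCHypWild ↔ E1NCHypWildRest4 := e1NCHypWild_iff_rest3.trans e1NCHypWildRest3_iff_rest4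

/-- families: `E1NCHypWildRest4 → E1NCHyp`. [new] -/
theorem e1NCHyp_of_wildRest4 (hR : E1NCHypWildRest4) : E1NCHyp := e1NCHyp_of_wildRest3 (e1NCHypWildRest3_iff_rest4.mpr hR)

end Law

/-! ### §Carve — the column's carve with the latent-jet cell DISCHARGED -/

section Carve

open SubfieldContactClasses

/-- exact remainder form: `E1NCHypWildRest4 → E1TopSHeavyOffNC → E1TopSHeavy`. [new] -/
theorem e1TopSHeavy_of_wildRest4_offNC (hR : E1NCHypWildRest4) (hO : E1TopSHeavyOffNC) : E1TopSHeavy :=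
  e1TopSHeavy_of_wildRest3_offNC (e1NCHypWildRest3_iff_rest4.mpr hR) hO

/-- edge to the column item (26971): under `SubfieldContactAbs` and `E 5`,
`E1NCHypWildRest4 → E1NCEntryPerpetual → E1TopSFrozenOffNC → E1TopNoAbs`. [new] -/
theorem e1TopNoAbs_of_wildRest4 (hSC : SubfieldContactAbs) (h5 : E 5) (hR : E1NCHypWildRest4) (hE : E1NCEntryPerpetual)
    (hO : E1TopSFrozenOffNC) : E1TopNoAbs :=
  e1TopNoAbs_of_wildRest3 hSC h5 (e1NCHypWildRest3_iff_rest4.mpr hR) hE hO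

/-- edge to the live aside (item 27045): under `E 5`,
`E1NCHypWildRest4 → E1NCEntryPerpetual → E1TopSFrozenOffNC → E1TopGHeavy`. [new] -/
theorem e1TopGHeavy_of_wildRest4 (h5 : E 5) (hR : E1NCHypWildRest4) (hE : E1NCEntryPerpetual) (hO : E1TopSFrozenOffNC) :
    E1TopGHeavy :=
  e1TopGHeavy_of_wildRest3 h5 (e1NCHypWildRest3_iff_rest4.mpr hR) hE hO

end Carve

end Summit.ResolutionOfSingularities.ResolutionOfSingularities.Theorems.DeltaCutClasses

end
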